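import Literature.Probability.LatticeModels.AizenmanWickBoundLocal
import HarnessLib

/-!
# The misquoted forms of Aizenman's inequality are false, II: the DLR form and the moment form

Topic `Literature/Probability/LatticeModels`; family `crit-ising` (crit-ising.S13, the inputs of
Aizenman–Duminil-Copin 2021, Prop. 1.4). Continuation of the last section of
`AizenmanWickBoundLocal` ("the `S_{2n-4}` form quoted by Aizenman–Duminil-Copin fails at coincident
points": `not_pairingUpperBound_at_zero`, `not_pairingUpperBound`,
`not_aizenman_pairingSum_sub_nPoint_le_finite`). Two further named facts of the tree record,
verbatim, the form in which

* M. Aizenman, H. Duminil-Copin, *Marginal triviality of the scaling limits of critical 4D Ising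
  and `φ⁴₄` models*, Ann. of Math. **194** (2021) = arXiv:1912.07973v4, §6.3, eq. (6.44) (p. 42),

quotes Aizenman's bound on the deviation of the `2n`-point function from Wick's law — with the
`(2n-4)`-point function `S_β(x₁,…,x̸_i,…,x̸_j,…,x̸_k,…,x̸_l,…,x_{2n})` multiplying `U₄^β` — and the
moment bound (6.45) obtained from it by smearing (`⟨T_{f,L}^{2n-4}⟩` in the remainder; the same
display opens the proof of Panis, arXiv:2309.05797, Thm 5.5, p. 21):

* `aizenman_pairingSum_sub_nPoint_le` (`HighDimTrivialityWick`, Part J): the quoted inequality for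
  every DLR state `μ ∈ 𝒢(β, 0)`, `0 ≤ β ≤ β_c`, `d ≥ 2`;
* `aizenman_evenMoment_deviation_le` (`HighDimTrivialityMoments`, Part A): the smeared form
  `|⟨T_{f,L}^{2n}⟩ - (2n-1)!! ⟨T_{f,L}²⟩ⁿ| ≤ (3/2)(2n)⁴ ⟨T_{|f|,L}^{2n-4}⟩ ‖f‖_∞⁴ S(μ;L,r)`, all `n ≥ 2`.

Both are refuted here. The theorem actually proved in the source — M. Aizenman, Comm. Math.
Phys. **86** (1982), Prop. 12.1, eq. (12.3): `|S_{2n} - G_{2n}| ≤ (3/2) R_{2n}` with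
`R_{2n} = ∑ |U₄| G_{2n-4}(…)`, the **Wick functional** `G_{2n-4}` of the remaining points (also
Aizenman, CDM 2020, Prop. 7.2; Panis 2023, Prop. 4.6) — is the tree's `aizenman_wickDeviation_le_finite`
(`AizenmanWickBound`), from which the corrected smeared bound (Gaussian moment
`(2n-5)!! ⟨T_{|f|,L}²⟩^{n-2}` in place of `⟨T_{|f|,L}^{2n-4}⟩`) and
`aizenmanDuminilCopin_mgf_normalizedField_bound_abs` are re-derived there. Consequently every
theorem taking one of the two refuted facts as a hypothesis is vacuous:
`aizenman_evenMoment_deviation_le_of_pointwise`, `…_printRegime_of_pointwise` (`HighDimTrivialityWick`),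
`aizenmanDuminilCopin_mgf_normalizedField_bound_abs_of_moments`, `panis_mgf_normalizedField_bound_of_moments`,
`…_printRegime_of_facts` (`HighDimTrivialityMoments`), and
`IsingTrivialityFromDimensionFour.of_momentFacts` of
`Literature/Barriers/CriticalPhenomena/IsingTrivialityFromDimensionFourProofs` (the re-threading of
that barrier onto the source form is `IsingTrivialityFromDimensionFourWick`); the two facts must
leave the trust base.

## The computations

* DLR form: `PairingUpperBound μ` fails for every probability measure (`not_pairingUpperBound`,
  ten coincident points: `944 ≤ 630`), and `𝒢(0, 0)` on `ℤ²` is non-empty — it contains the free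
  state (`exists_freeMeasure_holds`, a theorem of the tree), while `0 ≤ β_c(2)` (`criticalBeta_nonneg`).
* Moment form: take `d = 2`, `β = 0`, the free state `μ`, `L = 1/2` (so `Λ_L = Λ_{rL} = {0}` and
  `Σ_L = ⟨σ₀²⟩ = 1`), `r = 1` and the test function `f(y) = max(0, 1 - 2‖y‖)` (continuous, values in
  `[0,1]`, vanishing off the ball of radius `1/2`, `f(0) = 1`, `f(2x) = 0` for `x ∈ ℤ² ∖ {0}`), for
  which `T_{f,L} = T_{|f|,L} = σ₀` and `S(μ; L, r) = |U₄(0,0,0,0)| = 2`, all for every probability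
  measure. The fact then asserts `(2n-1)!! - 1 ≤ 3 (2n)⁴ (sup f)⁴ ≤ 3 (2n)⁴` for all `n ≥ 2`,
  false at `n = 8` (`2027024 ≤ 196608`). With the Gaussian moment `(2n-5)!!` of the source form the
  right-hand side would be `3 (2n)⁴ (2n-5)!!`, and the inequality true.

## Contents

* `spinAt_pow_two_mul`, `nPoint_const_of_even`, `connectedFour_const` — correlations at coincident
  points (the two-point case is `twoPoint_spinAt_self` of `GaussianPairingBound`);
* `not_aizenman_pairingSum_sub_nPoint_le`;
* `norm_siteVec_zero`, `one_le_norm_siteVec_of_ne_zero`, `exists_testFn_delta`, `latticeBox_half`,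
  `blockSpinVariance_half`, `normalizedField_half_of_delta`, `ursellFourSum_half` — the data of
  the moment-form witness; `not_aizenman_evenMoment_deviation_le`.

What is NOT here: no statement about Aizenman–Duminil-Copin's Prop. 1.4 itself
(`aizenmanDuminilCopin_mgf_normalizedField_bound`, recorded as printed; for signed `f` its
normalisation by `exp(z²⟨T_{f,L}²⟩/2)` is not what (6.45)–(6.47) yield, see
`aizenmanDuminilCopin_mgf_normalizedField_bound_abs`), nor about the corrected facts of
`AizenmanWickBound`, which are consistent with these computations. No new definitions.
-/

noncomputable section

open MeasureTheory Finset
open scoped Nat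

namespace Literature.Probability.LatticeModels

/-! ### Correlation functions at coincident points -/

section Coincident

variable {V : Type*} (μ : Measure (SpinConfig V)) (v : V)

/-- An even power of a spin is `1`: `σ_v^{2k} = 1`. [folklore] -/
theorem spinAt_pow_two_mul (k : ℕ) (σ : SpinConfig V) : spinAt v σ ^ (2 * k) = 1 := by
  rw [pow_mul, spinAt_sq, one_pow]

/-- At coincident points an even correlation function is `1`: `⟨σ_v^{m}⟩_μ = 1` for even `m` and
every probability measure `μ`. [folklore] -/
theorem nPoint_const_of_even [IsProbabilityMeasure μ] {m : ℕ} (hm : Even m) :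
    nPoint μ spinAt (fun _ : Fin m => v) = 1 := by
  obtain ⟨k, rfl⟩ := hm
  have h : ∀ σ : SpinConfig V, ∏ _i : Fin (k + k), spinAt v σ = 1 := fun σ => by
    rw [Finset.prod_const, Finset.card_univ, Fintype.card_fin, ← two_mul, spinAt_pow_two_mul]
  simp only [nPoint, h, integral_const, smul_eq_mul, mul_one]
  simp

/-- At coincident points the connected four-point function is `U₄(v,v,v,v) = 1 - 3 = -2`, for
every probability measure. [folklore] -/
theorem connectedFour_const [IsProbabilityMeasure μ] :
    connectedFour μ spinAt (fun _ : Fin 4 => v) = -2 := by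
  have h4 : nPoint μ spinAt (fun _ : Fin 4 => v) = 1 := nPoint_const_of_even μ v (by decide)
  rw [connectedFour, h4, twoPoint_spinAt_self]
  norm_num

end Coincident

/-! ### The DLR form -/

-- names the `@[deprecated]` record `aizenman_pairingSum_sub_nPoint_le` of `HighDimTrivialityWick.lean` on purpose: this IS its
-- refutation (verdict clean-up 2026-08-15); REMOVE-WHEN the record is deleted from `HighDimTrivialityWick.lean`
set_option linter.deprecated false in
/-- **Refutation of `aizenman_pairingSum_sub_nPoint_le`** (the quoted inequality for the states
`μ ∈ 𝒢(β, 0)`, `0 ≤ β ≤ β_c`, `d ≥ 2`): at `d = 2`, `β = 0` the free state is such a state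
(`exists_freeMeasure_holds`, `criticalBeta_nonneg`), and `PairingUpperBound` fails for every
probability measure (`not_pairingUpperBound` of `AizenmanWickBoundLocal`: ten coincident points).
The source's inequality (Aizenman 1982, Prop. 12.1, Wick functional of the remaining points) is
`aizenman_wickDeviation_le_finite` / `WickDeviationBound` of `AizenmanWickBound`. [folklore] -/
theorem not_aizenman_pairingSum_sub_nPoint_le : ¬ aizenman_pairingSum_sub_nPoint_le := by
  intro h
  obtain ⟨μ, hμ, -, -⟩ := exists_freeMeasure_holds 2 (β := 0) 0 le_rfl le_rfl
  haveI : IsProbabilityMeasure μ := IsGibbsMeasure.isProbabilityMeasure hμ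
  exact not_pairingUpperBound μ (h le_rfl 0 le_rfl (criticalBeta_nonneg 2) μ hμ)

/-! #### The moment form -/

variable {d : ℕ}

/-- `siteVec 0 = 0` in norm: `‖siteVec 0‖ = 0`. [folklore] -/
theorem norm_siteVec_zero : ‖siteVec (0 : Site d)‖ = 0 := by
  simp [EuclideanSpace.norm_eq, siteVec_apply]

/-- A non-zero lattice point has Euclidean norm at least `1`. [folklore] -/
theorem one_le_norm_siteVec_of_ne_zero {x : Site d} (hx : x ≠ 0) : 1 ≤ ‖siteVec x‖ := by
  obtain ⟨j, hj⟩ := Function.ne_iff.mp hx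
  have h1 : (1 : ℝ) ≤ |((x j : ℤ) : ℝ)| := by
    rw [← Int.cast_abs]
    exact_mod_cast Int.one_le_abs hj
  calc (1 : ℝ) ≤ |((x j : ℤ) : ℝ)| := h1
    _ = ‖siteVec x j‖ := by rw [siteVec_apply, Real.norm_eq_abs]
    _ ≤ ‖siteVec x‖ := PiLp.norm_apply_le (siteVec x) j

/-- **A test function isolating the spin at the origin at scale `L = 1/2`.** The function
`f(y) = max(0, 1 - 2‖y‖)` on `ℝ^d` is continuous, takes values in `[0, 1]`, vanishes outside the
cube `[-1, 1]^d` (indeed outside the ball of radius `1/2`), equals `1` at `2·0 = 0` and vanishes at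
`2x` for every `x ∈ ℤ^d ∖ {0}` (`‖2x‖ ≥ 2`). [folklore] -/
theorem exists_testFn_delta (d : ℕ) :
    ∃ f : EuclideanSpace ℝ (Fin d) → ℝ, Continuous f ∧ (∀ y, f y ≠ 0 → ∀ i, |y i| ≤ 1) ∧
      (∀ y, 0 ≤ f y) ∧ (∀ y, f y ≤ 1) ∧ f ((2⁻¹ : ℝ)⁻¹ • siteVec (0 : Site d)) = 1 ∧
      ∀ x : Site d, x ≠ 0 → f ((2⁻¹ : ℝ)⁻¹ • siteVec x) = 0 := by
  refine ⟨fun y => max 0 (1 - 2 * ‖y‖), ?_, ?_, ?_, ?_, ?_, ?_⟩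
  · exact continuous_const.max (continuous_const.sub (continuous_const.mul continuous_norm))
  · intro y hy i
    have h1 : ‖y‖ ≤ 1 := by
      by_contra hlt
      exact hy (max_eq_left (by linarith [not_le.mp hlt]))
    calc |y i| = ‖y i‖ := (Real.norm_eq_abs _).symm
      _ ≤ ‖y‖ := PiLp.norm_apply_le y i
      _ ≤ 1 := h1
  · exact fun y => le_max_left _ _
  · exact fun y => max_le zero_le_one (by linarith [norm_nonneg y])
  · show max 0 (1 - 2 * ‖(2⁻¹ : ℝ)⁻¹ • siteVec (0 : Site d)‖) = 1
    rw [norm_smul, norm_siteVec_zero, mul_zero, mul_zero, sub_zero, max_eq_right zero_le_one]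
  · intro x hx
    show max 0 (1 - 2 * ‖(2⁻¹ : ℝ)⁻¹ • siteVec x‖) = 0
    rw [norm_smul, inv_inv, Real.norm_eq_abs, abs_of_pos two_pos]
    exact max_eq_left (by nlinarith [one_le_norm_siteVec_of_ne_zero hx])

/-- The box `Λ_{1/2} = [-1/2, 1/2]^d ∩ ℤ^d` is `{0}`. [folklore] -/
theorem latticeBox_half : latticeBox d 2⁻¹ = {0} := by
  ext x
  rw [mem_latticeBox, Finset.mem_singleton]
  constructor
  · intro h
    funext i
    have hi := h i
    have hlt : |x i| < 1 := by
      have : |((x i : ℤ) : ℝ)| < 1 := by linarith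
      exact_mod_cast this
    exact Int.abs_lt_one_iff.mp hlt
  · rintro rfl i
    simp

/-- Over the one-point box the block-spin second moment is `Σ_{1/2} = ⟨σ₀²⟩ = 1`, for every
probability measure. [folklore] -/
theorem blockSpinVariance_half (μ : Measure (SpinConfig (Site d))) [IsProbabilityMeasure μ] :
    blockSpinVariance μ 2⁻¹ = 1 := by
  simp only [blockSpinVariance, latticeBox_half, Finset.sum_singleton, spinAt_sq, integral_const,
    smul_eq_mul, mul_one]
  simp

/-- With `L = 1/2` and a test function `f` with `f(0) = 1`, `f(2x) = 0` (`x ∈ ℤ^d ∖ {0}`), the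
normalised field is the single spin `σ₀`: `T_{f,1/2} = Σ_{1/2}^{-1/2} ∑_x f(2x) σ_x = σ₀`. [folklore] -/
theorem normalizedField_half_of_delta (μ : Measure (SpinConfig (Site d))) [IsProbabilityMeasure μ]
    (f : EuclideanSpace ℝ (Fin d) → ℝ) (hf0 : f ((2⁻¹ : ℝ)⁻¹ • siteVec (0 : Site d)) = 1)
    (hfne : ∀ x : Site d, x ≠ 0 → f ((2⁻¹ : ℝ)⁻¹ • siteVec x) = 0) (σ : SpinConfig (Site d)) :
    normalizedField μ 2⁻¹ f σ = spinAt 0 σ := by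
  rw [normalizedField, blockSpinVariance_half, Real.sqrt_one, inv_one, one_mul]
  rw [finsum_eq_single _ (0 : Site d) fun x hx => by rw [hfne x hx, zero_mul]]
  rw [hf0, one_mul]

/-- With `L = 1/2`, `r = 1`: `S(μ; 1/2, 1) = |U₄(0,0,0,0)| / Σ_{1/2}² = 2`, for every probability
measure. [folklore] -/
theorem ursellFourSum_half (μ : Measure (SpinConfig (Site d))) [IsProbabilityMeasure μ] :
    ursellFourSum μ 2⁻¹ 1 = 2 := by
  have hbox : (Fintype.piFinset fun _ : Fin 4 => latticeBox d (1 * 2⁻¹)) = {fun _ => 0} := by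
    rw [one_mul, latticeBox_half]
    ext x
    simp only [Fintype.mem_piFinset, Finset.mem_singleton, funext_iff]
  rw [ursellFourSum, hbox, Finset.sum_singleton, connectedFour_const, blockSpinVariance_half]
  norm_num

/-- **Refutation of `aizenman_evenMoment_deviation_le`** (`HighDimTrivialityMoments`, Part A: the
smeared form `|⟨T_{f,L}^{2n}⟩ - (2n-1)!! ⟨T_{f,L}²⟩ⁿ| ≤ (3/2)(2n)⁴ ⟨T_{|f|,L}^{2n-4}⟩ ‖f‖_∞⁴ S(μ;L,r)`
of Aizenman–Duminil-Copin 2021, eq. (6.45) / Panis 2023, proof of Thm 5.5, first display, for all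
`n ≥ 2`). At `d = 2`, `β = 0`, the free state `μ ∈ 𝒢(0,0)` (`exists_freeMeasure_holds`),
`L = 1/2`, `r = 1` and the test function of `exists_testFn_delta` one has
`T_{f,L} = T_{|f|,L} = σ₀`, `S = 2`, `sup |f| ≤ 1`, and the asserted inequality at `n = 8` reads
`15!! - 1 = 2027024 ≤ 3·16⁴ (sup|f|)⁴ ≤ 196608`. (The bound that the sources' argument does give
has the Gaussian moment `(2n-5)!! ⟨T_{|f|,L}²⟩^{n-2}` in place of `⟨T_{|f|,L}^{2n-4}⟩`:
`abs_integral_normalizedField_pow_sub_le_of_wickBounds`, `AizenmanWickBound`.) [folklore] -/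
theorem not_aizenman_evenMoment_deviation_le : ¬ aizenman_evenMoment_deviation_le := by
  intro h
  obtain ⟨μ, hμ, -, -⟩ := exists_freeMeasure_holds 2 (β := 0) 0 le_rfl le_rfl
  haveI : IsProbabilityMeasure μ := IsGibbsMeasure.isProbabilityMeasure hμ
  obtain ⟨f, hfc, hfs, hf0, hf1, hfz, hfne⟩ := exists_testFn_delta 2
  have key := h le_rfl 0 2⁻¹ 1 le_rfl (criticalBeta_nonneg 2) (by norm_num) le_rfl μ hμ f hfc hfs
    8 (by norm_num)
  have habs : (fun y => |f y|) = f := funext fun y => abs_of_nonneg (hf0 y)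
  have hm : ∀ m : ℕ, Even m → ∫ σ, normalizedField μ 2⁻¹ f σ ^ m ∂μ = 1 := by
    intro m hm
    obtain ⟨k, rfl⟩ := hm
    simp only [normalizedField_half_of_delta μ f hfz hfne, ← two_mul, spinAt_pow_two_mul,
      integral_const, smul_eq_mul, mul_one]
    simp
  rw [habs, hm _ (by decide), hm _ (by decide), hm _ (by decide), ursellFourSum_half] at key
  have h0 : 0 ≤ iSup f := Real.iSup_nonneg hf0
  have h1 : iSup f ≤ 1 := ciSup_le hf1
  have hs4 : iSup f ^ 4 ≤ 1 := pow_le_one₀ h0 h1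
  norm_num [Nat.factorial] at key
  nlinarith [key, hs4, pow_nonneg h0 4]

end Literature.Probability.LatticeModels
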